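import Mathlib
import HarnessLib
import Summits.Ventures.LatticeQCDFlow.Exactness.SphereLuscherConstantsParity
import Summits.Ventures.LatticeQCDFlow.Exactness.WilsonFlowMasks

/-!
# The periodic hypercubic lattice with even sides is a bipartite coupling graph: for the CP(N−1)/O(N) action with nearest-neighbour transporters on `(ℤ/L)^ν`, `L` even, every even constant of Lüscher's recursion vanishes (`ċ₂ = ċ₄ = … = 0`); odd sides admit no such bipartition

HONEST FRAMING: exact (Metropolis-corrected) sampling algorithms for lattice gauge theory;
figures of merit are autocorrelation/cost numbers at stated couplings and volumes; no
continuum-physics claim.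

Venture `LatticeQCDFlow` (cell pub-lqcd), topic `Exactness`; FANOUT row 7 (`s0-cpn-null`: the
S0-D1 rung — 2D CP⁹ on periodic `L × L` lattices, Lüscher's LO trivializing map inside HMC,
Engel–Schaefer 2011).  NEW WORK of the cell over the tree's
`Exactness/SphereLuscherConstantsParity.lean` (GEN-12 T4: on a BIPARTITE coupling graph —
`U_nm ≠ 0 ⇒` exactly one of `n, m` in `A` — the sublattice flip reverses `S − S₀`, all odd central
moments of the E–S action vanish and `ċ_{2j} = 0` for `j ≥ 1`) and
`Exactness/WilsonFlowMasks.lean` (row 14: the parity phase `x ↦ (Σ_i x_i) mod 2` on the torus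
`Site ν L = (ℤ/L)^ν` advances by one under every unit shift when `2 ∣ L` — `exists_phaseMask` —
and a two-class proper colouring forces `L` even — `even_of_twoClassMask`); the torus itself is the
tree's `Literature/…/ConstructiveQFTWave0` (`Site`, `Site.shift`).  Nothing is cited as a fact.
Printed counterpart, NAMED ONLY: Engel–Schaefer, Comput. Phys. Commun. 182 (2011) 2107, §2 (the
CP(N−1) action with nearest-neighbour link-transported couplings on the periodic square lattice);
M. Lüscher, Commun. Math. Phys. 293 (2010) 899, §4.2 (the constants `Ċ_t`).

THIS FILE supplies the instantiation left open in T4's NOT-CLAIMED list ("the square-lattice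
instantiation of the bipartite hypothesis — needs even side lengths; not constructed"):

* §1 **`torus_even_sublattice`** — for `L` even there is a set `A ⊆ (ℤ/L)^ν` (the even
  sublattice) with `x ∈ A ↔ x + e_i ∉ A` for every site `x` and direction `i`;
  **`torus_nn_bipartite`** — hence every NEAREST-NEIGHBOUR coupling family
  (`U x y ≠ 0 ⇒ y = x + e_i ∨ x = y + e_i` for some `i`) is bipartite in T4's sense;
  **`torus_no_bipartition_of_odd`** — conversely, for `L` odd and `ν ≥ 1` NO set `A` has the
  alternation property (walk once around the torus: `WilsonFlowMasks.even_of_twoClassMask`), so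
  T4's hypothesis is unavailable exactly when the engine refuses parity masks.
* §2 **`integral_odd_pow_esAction_sub_eq_zero_torus`** — on `(ℤ/L)^ν` with `L` even and
  nearest-neighbour transporters, `∫(S₀ − S)^{2j+1} dπ̄ = 0` for all `j`;
  **`luscher_constant_even_eq_zero_esAction_torus`** — and EVERY `C²` Lüscher series of the
  E–S action has `ċ_{2j} = 0` for all `j ≥ 1` (`Ċ_t + S₀` is odd in the flow time); in particular
  **`luscher_constant_two_eq_zero_esAction_torus`**: the NNLO constant `ċ₂` vanishes for the
  rung's own action on its own lattices (`ν = 2`, even `L`) — and in any dimension `ν`.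

NOT CLAIMED: anything for odd `L` beyond the absence of a bipartition (for `L = 3` the torus has
triangles and `ċ₂ ≠ 0` in general; for odd `L ≥ 5` the graph is triangle-free but not bipartite);
unequal side lengths (the tree's torus has equal sides); odd constants; convergence; the rung's
numbers.
-/

noncomputable section

namespace Summit.Ventures.LatticeQCDFlow.Exactness

open Function Set Metric MeasureTheory NormedSpace InnerProductSpace
  Literature.MathematicalPhysics.QuantumFieldTheory
open scoped RealInnerProductSpace

/-! ## §1 The even sublattice of the torus `(ℤ/L)^ν` -/

section Torus

variable {ν L : ℕ}

/-- **The even sublattice.**  For `L` even there is `A ⊆ (ℤ/L)^ν` such that every unit shift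
leaves / enters `A`: `x ∈ A ↔ x + e_i ∉ A` (take `A = {x : (Σ_j x_j) mod 2 = 0}`; the parity phase of
`WilsonFlowMasks.exists_phaseMask` advances by `1` in `ℤ/2` under each shift). -/
theorem torus_even_sublattice (hL : Even L) :
    ∃ A : Set (Site ν L), ∀ (x : Site ν L) (i : Fin ν), x ∈ A ↔ x.shift i ∉ A := by
  obtain ⟨χ, hχ⟩ := exists_phaseMask (d := ν) (L := L) 2 (even_iff_two_dvd.mp hL)
  refine ⟨{x | χ x = 0}, fun x i => ?_⟩
  simp only [mem_setOf_eq, hχ x i]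
  generalize χ x = z
  revert z
  decide

/-- **Nearest-neighbour couplings on an even torus are bipartite** (T4's hypothesis): if
`U x y ≠ 0` only when `y = x + e_i` or `x = y + e_i` for some direction `i`, then with `A` the even
sublattice, `U x y ≠ 0 ⇒ (x ∈ A ↔ y ∉ A)`. -/
theorem torus_nn_bipartite (hL : Even L) {β : Type*} [Zero β] (U : Site ν L → Site ν L → β)
    (hNN : ∀ x y, U x y ≠ 0 → ∃ i : Fin ν, y = x.shift i ∨ x = y.shift i) :
    ∃ A : Set (Site ν L), ∀ x y, U x y ≠ 0 → (x ∈ A ↔ y ∉ A) := by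
  obtain ⟨A, hA⟩ := torus_even_sublattice (ν := ν) hL
  refine ⟨A, fun x y hU => ?_⟩
  obtain ⟨i, h | h⟩ := hNN x y hU
  · rw [h]
    exact hA x i
  · rw [h, hA y i, not_not]

/-- **Odd sides admit no bipartition compatible with the shifts** (`ν ≥ 1`): if some `A` had
`x ∈ A ↔ x + e_i ∉ A` for all `x`, `i`, the indicator of `A` would be a proper two-class colouring
of the torus graph, which forces `L` even (`WilsonFlowMasks.even_of_twoClassMask`). -/
theorem torus_no_bipartition_of_odd (hν : 0 < ν) (hL : ¬Even L) (A : Set (Site ν L)) :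
    ¬∀ (x : Site ν L) (i : Fin ν), x ∈ A ↔ x.shift i ∉ A := by
  intro hA
  refine hL (even_of_twoClassMask hν (fun x : Site ν L => (x ∈ A : Prop)) (a := True) (b := False)
    (fun x => ?_) fun x i h => ?_)
  · by_cases hx : x ∈ A
    · exact Or.inl (eq_true hx)
    · exact Or.inr (eq_false hx)
  · have h' : x.shift i ∈ A ↔ x ∈ A := Iff.of_eq h
    by_cases hx : x ∈ A
    · exact (hA x i).mp hx (h'.mpr hx)
    · exact hx (h'.mp (not_not.mp (mt (hA x i).mpr hx)))

end Torus

/-! ## §2 The E–S action with nearest-neighbour transporters on an even torus -/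

section Action

variable {ν L : ℕ} [NeZero L] {E : Type*} [NormedAddCommGroup E] [InnerProductSpace ℝ E]
  [FiniteDimensional ℝ E] [MeasurableSpace E] [BorelSpace E] [Nontrivial E]
  {U : Site ν L → Site ν L → (E →L[ℝ] E)}

/-- **Every odd central moment of the CP(N−1)/O(N) action vanishes on an even torus**: for
nearest-neighbour transporters on `(ℤ/L)^ν`, `L` even, `∫(S₀ − S)^{2j+1} dπ̄ = 0` (T4's sublattice
flip on the even sublattice). -/
theorem integral_odd_pow_esAction_sub_eq_zero_torus (hL : Even L)
    (hNN : ∀ x y, U x y ≠ 0 → ∃ i : Fin ν, y = x.shift i ∨ x = y.shift i) (κ S₀ : ℝ) (j : ℕ) :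
    ∫ ω, (S₀ - esAction κ S₀ U (fun m => ((ω : Site ν L → sphere (0 : E) 1) m : E))) ^ (2 * j + 1)
      ∂Measure.pi (fun _ : Site ν L => uniformSphere (volume : Measure E)) = 0 := by
  classical
  obtain ⟨A, hA⟩ := torus_nn_bipartite hL U hNN
  exact integral_odd_pow_esAction_sub_eq_zero (A := A) hA κ S₀ j

variable {St : ℕ → (Site ν L → E) → ℝ} {c : ℕ → ℝ}

/-- **ON AN EVEN TORUS EVERY EVEN CONSTANT OF LÜSCHER'S RECURSION FOR THE CP(N−1)/O(N) ACTION
VANISHES**: for nearest-neighbour transporters on `(ℤ/L)^ν` with `L` even — the rung's lattices for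
`ν = 2` — every `C²` Lüscher series of `S = esAction κ S₀ U` has `ċ_{2j} = 0` for all `j ≥ 1`
(`Ċ_t + S₀` is an odd function of the flow time). -/
theorem luscher_constant_even_eq_zero_esAction_torus (hL : Even L)
    (hNN : ∀ x y, U x y ≠ 0 → ∃ i : Fin ν, y = x.shift i ∨ x = y.shift i) (κ S₀ : ℝ)
    (hSt : ∀ k, ContDiff ℝ 2 (St k))
    (h0 : ∀ ξ : Site ν L → sphere (0 : E) 1,
      -∑ n, siteLaplacian n (St 0) (fun m => (ξ m : E)) = esAction κ S₀ U (fun m => (ξ m : E)) + c 0)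
    (hs : ∀ k, ∀ ξ : Site ν L → sphere (0 : E) 1,
      -∑ n, siteLaplacian n (St (k + 1)) (fun m => (ξ m : E)) =
        -(∑ n, ⟪siteGrad n (esAction κ S₀ U) (fun m => (ξ m : E)),
            siteGrad n (St k) (fun m => (ξ m : E))⟫) + c (k + 1))
    {j : ℕ} (hj : 1 ≤ j) : c (2 * j) = 0 := by
  classical
  obtain ⟨A, hA⟩ := torus_nn_bipartite hL U hNN
  exact luscher_constant_even_eq_zero_esAction_bipartite (A := A) hA κ S₀ hSt h0 hs hj

/-- In particular **`ċ₂ = 0` for the rung's own action on its own (even, periodic) lattices**, in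
any dimension `ν`. -/
theorem luscher_constant_two_eq_zero_esAction_torus (hL : Even L)
    (hNN : ∀ x y, U x y ≠ 0 → ∃ i : Fin ν, y = x.shift i ∨ x = y.shift i) (κ S₀ : ℝ)
    (hSt : ∀ k, ContDiff ℝ 2 (St k))
    (h0 : ∀ ξ : Site ν L → sphere (0 : E) 1,
      -∑ n, siteLaplacian n (St 0) (fun m => (ξ m : E)) = esAction κ S₀ U (fun m => (ξ m : E)) + c 0)
    (hs : ∀ k, ∀ ξ : Site ν L → sphere (0 : E) 1,
      -∑ n, siteLaplacian n (St (k + 1)) (fun m => (ξ m : E)) =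
        -(∑ n, ⟪siteGrad n (esAction κ S₀ U) (fun m => (ξ m : E)),
            siteGrad n (St k) (fun m => (ξ m : E))⟫) + c (k + 1)) :
    c 2 = 0 :=
  luscher_constant_even_eq_zero_esAction_torus hL hNN κ S₀ hSt h0 hs (j := 1) le_rfl

end Action

end Summit.Ventures.LatticeQCDFlow.Exactness

end
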